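import Summits.NavierStokesRegularity.NavierStokesRegularity.Theorems.AdaptedFrequencyAdaptedKernelExistsPackagingEnvelope
import Summits.NavierStokesRegularity.NavierStokesRegularity.Theorems.AdaptedFrequencyAdaptedKernelExistsPackagingMass

/-!
# Crux `AdaptedKernelExists` (stmt-NavierStokesRegularity-2956), line `nash-entropy-last-block`:
  STUB `stub_kernelPackaging` (packaging the adapted kernel)

Lands `--supports stmt-NavierStokesRegularity-2956` the registered stub `stub_kernelPackaging` of
the line's skeleton. Setting: `ν > 0`, `ta < tₘ < Ta < T`, a drift `b` jointly smooth on
`Ico ta T × ℝ³`, divergence free, `‖b‖ ≤ B`; `g` jointly smooth on the open slab `Ioo ta T × ℝ³`,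
a classical solution of `∂ₜg + b·∇g + νΔg = 0` there, equal to the backward heat kernel
`Γ = backwardHeatKernel ν T x₀` on `Ico Ta T`, positive, and obeying the upper comparison
`g(t, x) ≤ ∫ Γ(Ta, z) k₊(ν(Ta−t) + σ₀, x − z) dz + δ` on `Ioo ta Ta`. CLAIM: `g` is an adapted
backward kernel of `∂ₜ + b·∇ − νΔ` on `Ico tₘ T` with pole `(T, x₀)`
(`IsAdaptedBackwardKernel ν b (Ico tₘ T) T x₀ g`) and has a Gaussian envelope on `Ioo ta T`.

Assembly of the two companion files: the ENVELOPE `g ≤ K₁ Γ₄`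
(`kernelPackaging_envelope_heat`, `stub_kernelPackaging_envelope` of `…PackagingEnvelope`), which
also gives integrable slices of mass `≤ K₁` (`kernelPackaging_integrable_of_le`), and the UNIT
MASS (`kernelPackaging_mass` of `…PackagingMass`). The remaining clauses: `C²` on the smaller
slab; positivity (given); the adjoint equation with the one-sided `timeDerivWithin (Ico tₘ T)`,
which at the interior times `Ico tₘ T ⊆ Ioo ta T` is the two-sided derivative
(`IsSmoothSpaceTimeOn.timeDerivWithin_eq_of_subset`, `timeDerivWithin_eq_deriv`); concentration
at the pole, because `g(t) = Γ(t)` eventually as `t ↑ T` (`tendsto_integral_mul_backwardHeatKernel`).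
-/

noncomputable section

open MeasureTheory Set Filter Topology Metric Function Real
open scoped Laplacian ContDiff
open Literature.Analysis.FluidPDE Literature.Analysis

namespace Summit.NavierStokesRegularity.NavierStokesRegularity.Theorems.AdaptedKernelExists.NashEntropyLastBlock

/-- **STUB `stub_kernelPackaging` — packaging the adapted kernel: envelope, unit mass,
concentration.** For `ν > 0`, `ta < tₘ < Ta < T`, `b` jointly smooth, divergence free and
bounded by `B` on `Ico ta T`, and `g` jointly smooth on `Ioo ta T`, a classical solution of
`∂ₜg + b·∇g + νΔg = 0` there with `g = Γ` on `Ico Ta T`, `g > 0`, and the upper comparison on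
`Ioo ta Ta`: `g` is an adapted backward kernel of `∂ₜ + b·∇ − νΔ` on `Ico tₘ T` with pole
`(T, x₀)`, and `g ≤ K (T−t)^{-3/2} e^{−‖x−x₀‖²/(a(T−t))}` on `Ioo ta T` for some `K`, `a > 0`. -/
theorem stub_kernelPackaging :
    ∀ (ν ta tₘ Ta T B : ℝ) (b : ℝ → EuclideanSpace ℝ (Fin 3) → EuclideanSpace ℝ (Fin 3))
      (x₀ : EuclideanSpace ℝ (Fin 3)) (g : ℝ → EuclideanSpace ℝ (Fin 3) → ℝ),
      0 < ν → ta < tₘ → tₘ < Ta → Ta < T →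
      IsSmoothSpaceTimeOn (Ico ta T) b →
      (∀ t ∈ Ico ta T, VectorCalculus.IsDivFree (b t)) →
      (∀ t ∈ Ico ta T, ∀ x, ‖b t x‖ ≤ B) →
      IsSmoothSpaceTimeOn (Ioo ta T) g →
      (∀ t ∈ Ioo ta T, ∀ x,
        deriv (fun s => g s x) t + fderiv ℝ (g t) x (b t x) + ν * (Δ (g t)) x = 0) →
      (∀ t ∈ Ico Ta T, g t = backwardHeatKernel ν T x₀ t) →
      (∀ t ∈ Ioo ta T, ∀ x, 0 < g t x) →
      (∀ t ∈ Ioo ta Ta, ∀ x, ∀ δ : ℝ, 0 < δ → ∃ σ₀ : ℝ, 0 < σ₀ ∧ σ₀ ≤ ν * (Ta - t) ∧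
        g t x ≤ (∫ z, backwardHeatKernel ν T x₀ Ta z *
            driftKernel 1 (B / ν) (ν * (Ta - t) + σ₀) (x - z)) + δ) →
      IsAdaptedBackwardKernel ν b (Ico tₘ T) T x₀ g ∧
      ∃ K a : ℝ, 0 < a ∧ ∀ t ∈ Ioo ta T, ∀ x,
        g t x ≤ K * (T - t) ^ (-(3:ℝ) / 2) * Real.exp (-(‖x - x₀‖ ^ 2) / (a * (T - t))) := by
  intro ν ta tₘ Ta T B b x₀ g hν htm hmA hTa hb hdiv hbB hg heq hΓ hpos hcomp
  have hta : ta < Ta := htm.trans hmA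
  have hB : 0 ≤ B := (norm_nonneg (b ta 0)).trans (hbB ta ⟨le_rfl, hta.trans hTa⟩ 0)
  -- the envelope, integrability and the mass bound of the slices
  obtain ⟨K₁, -, henv⟩ := kernelPackaging_envelope_heat hν hta hTa hB hΓ hcomp
  have h4ν : 0 < 4 * ν := by positivity
  have hgi : ∀ s ∈ Ioo ta T, Integrable (g s) ∧ ∫ x, g s x ≤ K₁ := fun s hs =>
    kernelPackaging_integrable_of_le h4ν hs.2 (hg.contDiff_slice hs).continuous
      (fun x => (hpos s hs x).le) (henv s hs)
  -- unit mass
  have hmass : ∀ t ∈ Ioo ta T, ∫ x, g t x = 1 := fun t ht =>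
    kernelPackaging_mass hν hta hTa hb hdiv hbB hg heq hΓ (fun s hs x => (hpos s hs x).le)
      (fun s hs => (hgi s hs).1) (fun s hs => (hgi s hs).2) ht
  have hsub : Ico tₘ T ⊆ Ioo ta T := fun t ht => ⟨htm.trans_le ht.1, ht.2⟩
  refine ⟨⟨?_, fun t ht x => hpos t (hsub ht) x, ?_, fun t ht => hmass t (hsub ht), ?_⟩,
    stub_kernelPackaging_envelope ν ta Ta T B x₀ g hν hta hTa hB hΓ hcomp⟩
  · -- jointly `C²` on the smaller slab
    exact (hg.mono hsub).of_le (by norm_cast)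
  · -- the adjoint equation with the one-sided time derivative
    intro t ht x
    rw [hg.timeDerivWithin_eq_of_subset hsub (uniqueDiffOn_Ico tₘ T) ht x,
      timeDerivWithin_eq_deriv isOpen_Ioo (hsub ht) g x]
    exact heq t (hsub ht) x
  · -- concentration at the pole: `g(t) = Γ(t)` for `t ∈ Ico Ta T`
    intro φ hφ hM
    obtain ⟨M, hM⟩ := hM
    have hev : (fun t => ∫ x, φ x * backwardHeatKernel ν T x₀ t x) =ᶠ[𝓝[<] T]
        fun t => ∫ x, φ x * g t x := by
      filter_upwards [Ico_mem_nhdsLT hTa] with t ht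
      rw [hΓ t ht]
    exact (tendsto_integral_mul_backwardHeatKernel hν T x₀ hφ hM).congr' hev

end Summit.NavierStokesRegularity.NavierStokesRegularity.Theorems.AdaptedKernelExists.NashEntropyLastBlock

end
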